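import Summits.Ventures.CertifiedManyBodySolver.Downfold.EmeryBandJet
import Summits.Ventures.CertifiedManyBodySolver.Downfold.EmeryFermiSurfaceHarmonics
import HarnessLib

/-!
# THE NESTING FOLD OF THE JET IS ENERGY-BLIND — AND SURVIVES `t_pp″`, `t_dd`: the 2-jet of the implicit band of the
# EXTENDED secular polynomial `charPoly6` (σ quartet + same-sublattice `t_pp″` + direct `t_dd`), its exact second-order
# identity, and the law `t′_J − 2t″_J = (∂ₓ∂_yF − ∂ₓ²F)/(16∂_εF)` — object M's fold is object E's fold over the velocity
# denominator for the extended model too (INFL-3to1-B §B.100 (g); continues `EmeryBandJet` / `EmeryFermiSurfaceHarmonics`)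

Venture CertifiedManyBodySolver, cell `pub/hubbard-downfold` (stage S1), seat hubbard-downfold-mod-4 (technique B, g44);
namespace `Summit.Ventures.CertifiedManyBodySolver.Downfold.Emery`. Everything PROVED (exact algebra; the partial
derivatives and the remainder were generated by a seat-side CAS and are CHECKED here by `ring`).

* §1 The exact second-order Taylor identity of `charPoly6` in `(u, v, h)` (`charPoly6_taylor2`): explicit polynomial
  partials `p6x` (∂ₓF), `p6y`, `p6e` (∂_εF), `p6xx2` (½∂ₓ²F — NON-ZERO: `t_pp″` and `t_dd` give the secular polynomial
  genuine `x²` content), `p6yy2`, `p6xy`, `p6xe`, `p6ye`, `p6ee2`, remainder `jet6Rem` (all monomials of total degree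
  ≥ 3 in `(u, v, h)`); at `c₂ = d = 0` they reduce to §B.100's (`p6e_zero_zero = dcharCubic`, `p6x_zero_zero = −gradX`,
  `p6xx2_zero_zero = 0`, `p6xy_zero_zero = −16fsN`, `p6xe_zero_zero = −dgradX`, `p6ee2_zero_zero = taylor2`).
* §2 The closed-form 2-jet `jet6P/Q/R/W/S` (implicit differentiation with `∂ₓ²F ≠ 0`), the degree grouping
  (`charPoly6_jet_expand`), `jet6_order1/2` (the closed forms kill the degree-1 and degree-2 groups, `∂_εF ≠ 0`) and
  **`charPoly6_jet_residual`**: `F(x + u, y + v, ε + jet(u, v)) = F + (degree ≥ 3)`.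
* §3 THE ENERGY-BLIND FOLD: at a diagonal point **`jet6_fold`: `t′_J − 2t″_J = (p6xy − 2·p6xx2)/(16·p6e)`** — every
  ε-derivative (`p6xe`, `p6ee2`) CANCELS in the combination `E_xx − E_xy`: the fold of the local one-band jet sees only
  the `(x, y)`-Hessian of the secular polynomial, i.e. the CONTOUR's own `xy` and `x²` weights; with `d = 0`
  (`jet6_fold_tdd_zero`): **`t′_J − 2t″_J = (fsTp5 − 2·fsTpp5)/∂_εF`** — object M's `t′ − 2t″` of the σ + `t_pp″` model
  equals object E's (the exact `t–t′–t″` contour's, `EmeryFermiSurfaceHarmonics` §3) `t′ − 2t″` over the velocity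
  denominator, EXACTLY; at `c₂ = d = 0` this is §B.100's `−fsN/∂_εF`.

WHAT THIS IS NOT: statements about materials; `U = 0` one-body kinematics; only ratios/contours are physical.
Sources: [AndersenEtAl1995, §6]; [PavariniEtAl2001, Eq. (1)].
-/

noncomputable section

namespace Summit.Ventures.CertifiedManyBodySolver.Downfold.Emery

open Real

/-! ## §1 Partials of `charPoly6` and the exact second-order Taylor identity -/

/-- `∂ₓ charPoly6` (explicit polynomial; CAS-generated, checked by `charPoly6_taylor2`). [folklore] -/
def p6x (Δ tpd tpp c c₂ d x y ε : ℝ) : ℝ :=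
  (64 : ℝ) * c₂ ^ 2 * d * y ^ 2 + (128 : ℝ) * c₂ ^ 2 * d * x * y + (64 : ℝ) * c * c₂ * d * y ^ 2 + (128 : ℝ) * c * c₂ * d * x * y + (192 : ℝ) * c * c₂ * d * x ^ 2 + (64 : ℝ) * c ^ 2 * d * y ^ 2 + (128 : ℝ) * c ^ 2 * d * x * y + (-64 : ℝ) * tpp ^ 2 * d * y ^ 2 + (-128 : ℝ) * tpp ^ 2 * d * x * y + (32 : ℝ) * c₂ * d * y * ε + (32 : ℝ) * c₂ * d * x * ε + (16 : ℝ) * c₂ ^ 2 * y * ε + (-64 : ℝ) * c₂ ^ 2 * d * y + (32 : ℝ) * c * d * y * ε + (32 : ℝ) * c * d * x * ε + (32 : ℝ) * c * c₂ * x * ε + (-128 : ℝ) * c * c₂ * d * x + (16 : ℝ) * c ^ 2 * y * ε + (-64 : ℝ) * c ^ 2 * d * y + (-16 : ℝ) * tpp ^ 2 * y * ε + (64 : ℝ) * tpp ^ 2 * d * y + (32 : ℝ) * Δ * c₂ * d * y + (32 : ℝ) * Δ * c₂ * d * x + (32 : ℝ) * Δ * c * d * y + (32 : ℝ) * Δ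 * c * d * x + (4 : ℝ) * d * ε ^ 2 + (4 : ℝ) * c₂ * ε ^ 2 + (-16 : ℝ) * c₂ * d * ε + (4 : ℝ) * c * ε ^ 2 + (-16 : ℝ) * c * d * ε + (-32 : ℝ) * tpd ^ 2 * c₂ * x + (-32 : ℝ) * tpd ^ 2 * c * y + (-32 : ℝ) * tpd ^ 2 * tpp * y + (8 : ℝ) * Δ * d * ε + (4 : ℝ) * Δ * c₂ * ε + (-16 : ℝ) * Δ * c₂ * d + (4 : ℝ) * Δ * c * ε + (-16 : ℝ) * Δ * c * d + (4 : ℝ) * Δ ^ 2 * d + (-4 : ℝ) * tpd ^ 2 * ε + (-4 : ℝ) * Δ * tpd ^ 2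

/-- `∂_y charPoly6` (explicit polynomial; CAS-generated, checked by `charPoly6_taylor2`). [folklore] -/
def p6y (Δ tpd tpp c c₂ d x y ε : ℝ) : ℝ :=
  (128 : ℝ) * c₂ ^ 2 * d * x * y + (64 : ℝ) * c₂ ^ 2 * d * x ^ 2 + (192 : ℝ) * c * c₂ * d * y ^ 2 + (128 : ℝ) * c * c₂ * d * x * y + (64 : ℝ) * c * c₂ * d * x ^ 2 + (128 : ℝ) * c ^ 2 * d * x * y + (64 : ℝ) * c ^ 2 * d * x ^ 2 + (-128 : ℝ) * tpp ^ 2 * d * x * y + (-64 : ℝ) * tpp ^ 2 * d * x ^ 2 + (32 : ℝ) * c₂ * d * y * ε + (32 : ℝ) * c₂ * d * x * ε + (16 : ℝ) * c₂ ^ 2 * x * ε + (-64 : ℝ) * c₂ ^ 2 * d * x + (32 : ℝ) * c * d * y * ε + (32 : ℝ) * c * d * x * ε + (32 : ℝ) * c * c₂ * y * ε + (-128 : ℝ) * c * c₂ * d * y + (16 : ℝ) * c ^ 2 * x * ε + (-64 : ℝ) * c ^ 2 * d * x + (-16 : ℝ) * tpp ^ 2 * x * ε + (64 : ℝ) * tpp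 ^ 2 * d * x + (32 : ℝ) * Δ * c₂ * d * y + (32 : ℝ) * Δ * c₂ * d * x + (32 : ℝ) * Δ * c * d * y + (32 : ℝ) * Δ * c * d * x + (4 : ℝ) * d * ε ^ 2 + (4 : ℝ) * c₂ * ε ^ 2 + (-16 : ℝ) * c₂ * d * ε + (4 : ℝ) * c * ε ^ 2 + (-16 : ℝ) * c * d * ε + (-32 : ℝ) * tpd ^ 2 * c₂ * y + (-32 : ℝ) * tpd ^ 2 * c * x + (-32 : ℝ) * tpd ^ 2 * tpp * x + (8 : ℝ) * Δ * d * ε + (4 : ℝ) * Δ * c₂ * ε + (-16 : ℝ) * Δ * c₂ * d + (4 : ℝ) * Δ * c * ε + (-16 : ℝ) * Δ * c * d + (4 : ℝ) * Δ ^ 2 * d + (-4 : ℝ) * tpd ^ 2 * ε + (-4 : ℝ) * Δ * tpd ^ 2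

/-- `∂_ε charPoly6` (explicit polynomial; CAS-generated, checked by `charPoly6_taylor2`). [folklore] -/
def p6e (Δ tpd tpp c c₂ d x y ε : ℝ) : ℝ :=
  (16 : ℝ) * c₂ * d * y ^ 2 + (32 : ℝ) * c₂ * d * x * y + (16 : ℝ) * c₂ * d * x ^ 2 + (16 : ℝ) * c₂ ^ 2 * x * y + (16 : ℝ) * c * d * y ^ 2 + (32 : ℝ) * c * d * x * y + (16 : ℝ) * c * d * x ^ 2 + (16 : ℝ) * c * c₂ * y ^ 2 + (16 : ℝ) * c * c₂ * x ^ 2 + (16 : ℝ) * c ^ 2 * x * y + (-16 : ℝ) * tpp ^ 2 * x * y + (8 : ℝ) * d * y * ε + (8 : ℝ) * d * x * ε + (8 : ℝ) * c₂ * y * ε + (8 : ℝ) * c₂ * x * ε + (-16 : ℝ) * c₂ * d * y + (-16 : ℝ) * c₂ * d * x + (8 : ℝ) * c * y * ε + (8 : ℝ) * c * x * ε + (-16 : ℝ) * c * d * y + (-16 : ℝ) * c * d * x + (8 : ℝ) * Δ * d * y + (8 : ℝ) * Δ * d * x + (4 : ℝ) * Δ * c₂ * y + (4 : ℝ) * Δ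 * c₂ * x + (4 : ℝ) * Δ * c * y + (4 : ℝ) * Δ * c * x + (3 : ℝ) * ε ^ 2 + (-8 : ℝ) * d * ε + (-4 : ℝ) * tpd ^ 2 * y + (-4 : ℝ) * tpd ^ 2 * x + (4 : ℝ) * Δ * ε + (-8 : ℝ) * Δ * d + (1 : ℝ) * Δ ^ 2

/-- `½∂ₓ² charPoly6` — non-zero through `t_pp″` (`−16t_pd²c₂ + …`) and `t_dd` (explicit polynomial; CAS-generated, checked by `charPoly6_taylor2`). [folklore] -/
def p6xx2 (Δ tpd tpp c c₂ d x y ε : ℝ) : ℝ :=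
  (64 : ℝ) * c₂ ^ 2 * d * y + (64 : ℝ) * c * c₂ * d * y + (192 : ℝ) * c * c₂ * d * x + (64 : ℝ) * c ^ 2 * d * y + (-64 : ℝ) * tpp ^ 2 * d * y + (16 : ℝ) * c₂ * d * ε + (16 : ℝ) * c * d * ε + (16 : ℝ) * c * c₂ * ε + (-64 : ℝ) * c * c₂ * d + (16 : ℝ) * Δ * c₂ * d + (16 : ℝ) * Δ * c * d + (-16 : ℝ) * tpd ^ 2 * c₂

/-- `½∂_y² charPoly6` (explicit polynomial; CAS-generated, checked by `charPoly6_taylor2`). [folklore] -/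
def p6yy2 (Δ tpd tpp c c₂ d x y ε : ℝ) : ℝ :=
  (64 : ℝ) * c₂ ^ 2 * d * x + (192 : ℝ) * c * c₂ * d * y + (64 : ℝ) * c * c₂ * d * x + (64 : ℝ) * c ^ 2 * d * x + (-64 : ℝ) * tpp ^ 2 * d * x + (16 : ℝ) * c₂ * d * ε + (16 : ℝ) * c * d * ε + (16 : ℝ) * c * c₂ * ε + (-64 : ℝ) * c * c₂ * d + (16 : ℝ) * Δ * c₂ * d + (16 : ℝ) * Δ * c * d + (-16 : ℝ) * tpd ^ 2 * c₂

/-- `∂ₓ∂_y charPoly6` (explicit polynomial; CAS-generated, checked by `charPoly6_taylor2`). [folklore] -/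
def p6xy (Δ tpd tpp c c₂ d x y ε : ℝ) : ℝ :=
  (128 : ℝ) * c₂ ^ 2 * d * y + (128 : ℝ) * c₂ ^ 2 * d * x + (128 : ℝ) * c * c₂ * d * y + (128 : ℝ) * c * c₂ * d * x + (128 : ℝ) * c ^ 2 * d * y + (128 : ℝ) * c ^ 2 * d * x + (-128 : ℝ) * tpp ^ 2 * d * y + (-128 : ℝ) * tpp ^ 2 * d * x + (32 : ℝ) * c₂ * d * ε + (16 : ℝ) * c₂ ^ 2 * ε + (-64 : ℝ) * c₂ ^ 2 * d + (32 : ℝ) * c * d * ε + (16 : ℝ) * c ^ 2 * ε + (-64 : ℝ) * c ^ 2 * d + (-16 : ℝ) * tpp ^ 2 * ε + (64 : ℝ) * tpp ^ 2 * d + (32 : ℝ) * Δ * c₂ * d + (32 : ℝ) * Δ * c * d + (-32 : ℝ) * tpd ^ 2 * c + (-32 : ℝ) * tpd ^ 2 * tpp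

/-- `∂ₓ∂_ε charPoly6` (explicit polynomial; CAS-generated, checked by `charPoly6_taylor2`). [folklore] -/
def p6xe (Δ tpd tpp c c₂ d x y ε : ℝ) : ℝ :=
  (32 : ℝ) * c₂ * d * y + (32 : ℝ) * c₂ * d * x + (16 : ℝ) * c₂ ^ 2 * y + (32 : ℝ) * c * d * y + (32 : ℝ) * c * d * x + (32 : ℝ) * c * c₂ * x + (16 : ℝ) * c ^ 2 * y + (-16 : ℝ) * tpp ^ 2 * y + (8 : ℝ) * d * ε + (8 : ℝ) * c₂ * ε + (-16 : ℝ) * c₂ * d + (8 : ℝ) * c * ε + (-16 : ℝ) * c * d + (8 : ℝ) * Δ * d + (4 : ℝ) * Δ * c₂ + (4 : ℝ) * Δ * c + (-4 : ℝ) * tpd ^ 2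

/-- `∂_y∂_ε charPoly6` (explicit polynomial; CAS-generated, checked by `charPoly6_taylor2`). [folklore] -/
def p6ye (Δ tpd tpp c c₂ d x y ε : ℝ) : ℝ :=
  (32 : ℝ) * c₂ * d * y + (32 : ℝ) * c₂ * d * x + (16 : ℝ) * c₂ ^ 2 * x + (32 : ℝ) * c * d * y + (32 : ℝ) * c * d * x + (32 : ℝ) * c * c₂ * y + (16 : ℝ) * c ^ 2 * x + (-16 : ℝ) * tpp ^ 2 * x + (8 : ℝ) * d * ε + (8 : ℝ) * c₂ * ε + (-16 : ℝ) * c₂ * d + (8 : ℝ) * c * ε + (-16 : ℝ) * c * d + (8 : ℝ) * Δ * d + (4 : ℝ) * Δ * c₂ + (4 : ℝ) * Δ * c + (-4 : ℝ) * tpd ^ 2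

/-- `½∂_ε² charPoly6` (explicit polynomial; CAS-generated, checked by `charPoly6_taylor2`). [folklore] -/
def p6ee2 (Δ _tpd _tpp c c₂ d x y ε : ℝ) : ℝ :=
  (4 : ℝ) * d * y + (4 : ℝ) * d * x + (4 : ℝ) * c₂ * y + (4 : ℝ) * c₂ * x + (4 : ℝ) * c * y + (4 : ℝ) * c * x + (3 : ℝ) * ε + (-4 : ℝ) * d + (2 : ℝ) * Δ

/-- The remainder of the second-order Taylor identity: every monomial has total degree ≥ 3 in `(u, v, h)`. [folklore] -/
def jet6Rem (_Δ _tpd tpp c c₂ d _x _y _ε u v h : ℝ) : ℝ :=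
  (64 : ℝ) * c₂ ^ 2 * d * u * v ^ 2 + (64 : ℝ) * c₂ ^ 2 * d * u ^ 2 * v + (64 : ℝ) * c * c₂ * d * v ^ 3 + (64 : ℝ) * c * c₂ * d * u * v ^ 2 + (64 : ℝ) * c * c₂ * d * u ^ 2 * v + (64 : ℝ) * c * c₂ * d * u ^ 3 + (64 : ℝ) * c ^ 2 * d * u * v ^ 2 + (64 : ℝ) * c ^ 2 * d * u ^ 2 * v + (-64 : ℝ) * tpp ^ 2 * d * u * v ^ 2 + (-64 : ℝ) * tpp ^ 2 * d * u ^ 2 * v + (16 : ℝ) * c₂ * d * v ^ 2 * h + (32 : ℝ) * c₂ * d * u * v * h + (16 : ℝ) * c₂ * d * u ^ 2 * h + (16 : ℝ) * c₂ ^ 2 * u * v * h + (16 : ℝ) * c * d * v ^ 2 * h + (32 : ℝ) * c * d * u * v * h + (16 : ℝ) * c * d * u ^ 2 * h + (16 : ℝ) * c * c₂ * v ^ 2 * h + (16 : ℝ) * c * c₂ * u ^ 2 * h + (16 : ℝ) * c ^ 2 * u * v * h + (-16 : ℝ) * tpp ^ 2 * u * v * h + (4 : ℝ) * d * v * h ^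 2 + (4 : ℝ) * d * u * h ^ 2 + (4 : ℝ) * c₂ * v * h ^ 2 + (4 : ℝ) * c₂ * u * h ^ 2 + (4 : ℝ) * c * v * h ^ 2 + (4 : ℝ) * c * u * h ^ 2 + (1 : ℝ) * h ^ 3

/-- THE EXACT SECOND-ORDER TAYLOR IDENTITY of `charPoly6` in `(u, v, h)`. [folklore] -/
theorem charPoly6_taylor2 (Δ tpd tpp c c₂ d x y ε u v h : ℝ) :
    charPoly6 Δ tpd tpp c c₂ d (x + u) (y + v) (ε + h) =
      charPoly6 Δ tpd tpp c c₂ d x y ε + u * p6x Δ tpd tpp c c₂ d x y ε + v * p6y Δ tpd tpp c c₂ d x y ε + h * p6e Δ tpd tpp c c₂ d x y ε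
      + u ^ 2 * p6xx2 Δ tpd tpp c c₂ d x y ε + v ^ 2 * p6yy2 Δ tpd tpp c c₂ d x y ε + u * v * p6xy Δ tpd tpp c c₂ d x y ε + u * h * p6xe Δ tpd tpp c c₂ d x y ε + v * h * p6ye Δ tpd tpp c c₂ d x y ε
      + h ^ 2 * p6ee2 Δ tpd tpp c c₂ d x y ε + jet6Rem Δ tpd tpp c c₂ d x y ε u v h := by
  unfold charPoly6 p6x p6y p6e p6xx2 p6yy2 p6xy p6xe p6ye p6ee2 jet6Rem
  ring

/-- At `c₂ = d = 0` the energy derivative is the quartet's `dcharCubic`. [folklore] -/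
theorem p6e_zero_zero (Δ tpd tpp c x y ε : ℝ) : p6e Δ tpd tpp c 0 0 x y ε = dcharCubic Δ tpd tpp c x y ε := by
  unfold p6e dcharCubic dcA dfsD dfsN; ring

/-- At `c₂ = d = 0`: `∂ₓF = −gradX`. [folklore] -/
theorem p6x_zero_zero (Δ tpd tpp c x y ε : ℝ) : p6x Δ tpd tpp c 0 0 x y ε = -gradX Δ tpd tpp c y ε := by
  unfold p6x gradX fsD fsN; ring

/-- At `c₂ = d = 0` the secular polynomial has NO `x²` content (§B.13 bilinearity). [folklore] -/
theorem p6xx2_zero_zero (Δ tpd tpp c x y ε : ℝ) : p6xx2 Δ tpd tpp c 0 0 x y ε = 0 := by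
  unfold p6xx2; ring

/-- At `c₂ = d = 0`: `∂ₓ∂_yF = −16fsN`. [folklore] -/
theorem p6xy_zero_zero (Δ tpd tpp c x y ε : ℝ) : p6xy Δ tpd tpp c 0 0 x y ε = -16 * fsN tpd tpp c ε := by
  unfold p6xy fsN; ring

/-- At `c₂ = d = 0`: `∂ₓ∂_εF = −dgradX`. [folklore] -/
theorem p6xe_zero_zero (Δ tpd tpp c x y ε : ℝ) : p6xe Δ tpd tpp c 0 0 x y ε = -dgradX Δ tpd tpp c y ε := by
  unfold p6xe dgradX dfsD dfsN; ring

/-- At `c₂ = d = 0`: `½∂_ε²F = taylor2`. [folklore] -/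
theorem p6ee2_zero_zero (Δ tpd tpp c x y ε : ℝ) : p6ee2 Δ tpd tpp c 0 0 x y ε = taylor2 Δ c x y ε := by
  unfold p6ee2 taylor2; ring

/-- With `d = 0` the `(x, y)`-Hessian is the `t–t′–t″` CONTOUR's: `½∂ₓ²F = −16fsM5`, `∂ₓ∂_yF = −16fsN5`
(`EmeryFermiSurfaceHarmonics.charPoly6_tdd_zero_symQuad`). [folklore] -/
theorem p6_hessian_tdd_zero (Δ tpd tpp c c₂ x y ε : ℝ) :
    p6xx2 Δ tpd tpp c c₂ 0 x y ε = -16 * fsM5 tpd c c₂ ε ∧ p6xy Δ tpd tpp c c₂ 0 x y ε = -16 * fsN5 tpd tpp c c₂ ε := by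
  constructor
  · unfold p6xx2 fsM5; ring
  · unfold p6xy fsN5; ring

/-! ## §2 The closed-form 2-jet of the extended band and its exact residual -/

/-- `E_x = −∂ₓF/∂_εF`. [folklore] -/
def jet6P (Δ tpd tpp c c₂ d x y ε : ℝ) : ℝ := -p6x Δ tpd tpp c c₂ d x y ε / p6e Δ tpd tpp c c₂ d x y ε

/-- `E_y = −∂_yF/∂_εF`. [folklore] -/
def jet6Q (Δ tpd tpp c c₂ d x y ε : ℝ) : ℝ := -p6y Δ tpd tpp c c₂ d x y ε / p6e Δ tpd tpp c c₂ d x y ε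

/-- `E_xx = −(∂ₓ²F + 2E_x∂ₓ∂_εF + E_x²∂_ε²F)/∂_εF`. [folklore] -/
def jet6R (Δ tpd tpp c c₂ d x y ε : ℝ) : ℝ :=
  -(2 * p6xx2 Δ tpd tpp c c₂ d x y ε + 2 * jet6P Δ tpd tpp c c₂ d x y ε * p6xe Δ tpd tpp c c₂ d x y ε + 2 * p6ee2 Δ tpd tpp c c₂ d x y ε * jet6P Δ tpd tpp c c₂ d x y ε ^ 2) / p6e Δ tpd tpp c c₂ d x y ε

/-- `E_yy`. [folklore] -/
def jet6W (Δ tpd tpp c c₂ d x y ε : ℝ) : ℝ :=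
  -(2 * p6yy2 Δ tpd tpp c c₂ d x y ε + 2 * jet6Q Δ tpd tpp c c₂ d x y ε * p6ye Δ tpd tpp c c₂ d x y ε + 2 * p6ee2 Δ tpd tpp c c₂ d x y ε * jet6Q Δ tpd tpp c c₂ d x y ε ^ 2) / p6e Δ tpd tpp c c₂ d x y ε

/-- `E_xy = −(∂ₓ∂_yF + E_y∂ₓ∂_εF + E_x∂_y∂_εF + E_xE_y∂_ε²F)/∂_εF`. [folklore] -/
def jet6S (Δ tpd tpp c c₂ d x y ε : ℝ) : ℝ :=
  -(p6xy Δ tpd tpp c c₂ d x y ε + jet6Q Δ tpd tpp c c₂ d x y ε * p6xe Δ tpd tpp c c₂ d x y ε + jet6P Δ tpd tpp c c₂ d x y ε * p6ye Δ tpd tpp c c₂ d x y ε + 2 * p6ee2 Δ tpd tpp c c₂ d x y ε * jet6P Δ tpd tpp c c₂ d x y ε * jet6Q Δ tpd tpp c c₂ d x y ε) / p6e Δ tpd tpp c c₂ d x y ε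

/-- THE DEGREE GROUPING along a quadratic energy surface `h = L + Q` (`L` linear, `Q` quadratic in `(u, v)`).
[folklore] -/
theorem charPoly6_jet_expand (Δ tpd tpp c c₂ d x y ε u v L Q : ℝ) :
    charPoly6 Δ tpd tpp c c₂ d (x + u) (y + v) (ε + (L + Q)) =
      charPoly6 Δ tpd tpp c c₂ d x y ε
      + (L * p6e Δ tpd tpp c c₂ d x y ε + u * p6x Δ tpd tpp c c₂ d x y ε + v * p6y Δ tpd tpp c c₂ d x y ε)
      + (Q * p6e Δ tpd tpp c c₂ d x y ε + u ^ 2 * p6xx2 Δ tpd tpp c c₂ d x y ε + v ^ 2 * p6yy2 Δ tpd tpp c c₂ d x y ε + u * v * p6xy Δ tpd tpp c c₂ d x y ε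
          + L * (u * p6xe Δ tpd tpp c c₂ d x y ε + v * p6ye Δ tpd tpp c c₂ d x y ε) + L ^ 2 * p6ee2 Δ tpd tpp c c₂ d x y ε)
      + ((u * p6xe Δ tpd tpp c c₂ d x y ε + v * p6ye Δ tpd tpp c c₂ d x y ε) * Q + (2 * L * Q + Q ^ 2) * p6ee2 Δ tpd tpp c c₂ d x y ε + jet6Rem Δ tpd tpp c c₂ d x y ε u v (L + Q)) := by
  rw [charPoly6_taylor2]
  ring

/-- The closed-form jet kills the degree-1 group (`∂_εF ≠ 0`). [folklore] -/
theorem jet6_order1 {Δ tpd tpp c c₂ d x y ε : ℝ} (hF : p6e Δ tpd tpp c c₂ d x y ε ≠ 0) (u v : ℝ) :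
    (jet6P Δ tpd tpp c c₂ d x y ε * u + jet6Q Δ tpd tpp c c₂ d x y ε * v) * p6e Δ tpd tpp c c₂ d x y ε + u * p6x Δ tpd tpp c c₂ d x y ε + v * p6y Δ tpd tpp c c₂ d x y ε = 0 := by
  unfold jet6P jet6Q; field_simp; ring

/-- The closed-form jet kills the degree-2 group (`∂_εF ≠ 0`). [folklore] -/
theorem jet6_order2 {Δ tpd tpp c c₂ d x y ε : ℝ} (hF : p6e Δ tpd tpp c c₂ d x y ε ≠ 0) (u v : ℝ) :
    (jet6R Δ tpd tpp c c₂ d x y ε * u ^ 2 / 2 + jet6S Δ tpd tpp c c₂ d x y ε * u * v + jet6W Δ tpd tpp c c₂ d x y ε * v ^ 2 / 2) * p6e Δ tpd tpp c c₂ d x y ε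
      + u ^ 2 * p6xx2 Δ tpd tpp c c₂ d x y ε + v ^ 2 * p6yy2 Δ tpd tpp c c₂ d x y ε + u * v * p6xy Δ tpd tpp c c₂ d x y ε
      + (jet6P Δ tpd tpp c c₂ d x y ε * u + jet6Q Δ tpd tpp c c₂ d x y ε * v) * (u * p6xe Δ tpd tpp c c₂ d x y ε + v * p6ye Δ tpd tpp c c₂ d x y ε)
      + (jet6P Δ tpd tpp c c₂ d x y ε * u + jet6Q Δ tpd tpp c c₂ d x y ε * v) ^ 2 * p6ee2 Δ tpd tpp c c₂ d x y ε = 0 := by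
  unfold jet6R jet6S jet6W; field_simp; ring

/-- **THE 2-JET PROPERTY OF THE EXTENDED BAND** (exact): `F(x + u, y + v, ε + jet(u, v)) = F(x, y, ε) + (degree ≥ 3)`
(`∂_εF ≠ 0`). [folklore] -/
theorem charPoly6_jet_residual {Δ tpd tpp c c₂ d x y ε : ℝ} (hF : p6e Δ tpd tpp c c₂ d x y ε ≠ 0) (u v : ℝ) :
    charPoly6 Δ tpd tpp c c₂ d (x + u) (y + v)
        (ε + ((jet6P Δ tpd tpp c c₂ d x y ε * u + jet6Q Δ tpd tpp c c₂ d x y ε * v) + (jet6R Δ tpd tpp c c₂ d x y ε * u ^ 2 / 2 + jet6S Δ tpd tpp c c₂ d x y ε * u * v + jet6W Δ tpd tpp c c₂ d x y ε * v ^ 2 / 2))) =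
      charPoly6 Δ tpd tpp c c₂ d x y ε
      + ((u * p6xe Δ tpd tpp c c₂ d x y ε + v * p6ye Δ tpd tpp c c₂ d x y ε) * (jet6R Δ tpd tpp c c₂ d x y ε * u ^ 2 / 2 + jet6S Δ tpd tpp c c₂ d x y ε * u * v + jet6W Δ tpd tpp c c₂ d x y ε * v ^ 2 / 2)
        + (2 * (jet6P Δ tpd tpp c c₂ d x y ε * u + jet6Q Δ tpd tpp c c₂ d x y ε * v) * (jet6R Δ tpd tpp c c₂ d x y ε * u ^ 2 / 2 + jet6S Δ tpd tpp c c₂ d x y ε * u * v + jet6W Δ tpd tpp c c₂ d x y ε * v ^ 2 / 2)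
            + (jet6R Δ tpd tpp c c₂ d x y ε * u ^ 2 / 2 + jet6S Δ tpd tpp c c₂ d x y ε * u * v + jet6W Δ tpd tpp c c₂ d x y ε * v ^ 2 / 2) ^ 2) * p6ee2 Δ tpd tpp c c₂ d x y ε
        + jet6Rem Δ tpd tpp c c₂ d x y ε u v ((jet6P Δ tpd tpp c c₂ d x y ε * u + jet6Q Δ tpd tpp c c₂ d x y ε * v)
            + (jet6R Δ tpd tpp c c₂ d x y ε * u ^ 2 / 2 + jet6S Δ tpd tpp c c₂ d x y ε * u * v + jet6W Δ tpd tpp c c₂ d x y ε * v ^ 2 / 2))) := by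
  rw [charPoly6_jet_expand, jet6_order1 hF u v, jet6_order2 hF u v]
  ring

/-! ## §3 The energy-blind fold of the extended jet -/

/-- At a diagonal point the two slopes agree. [folklore] -/
theorem jet6Q_diag (Δ tpd tpp c c₂ d x₀ ε : ℝ) : jet6Q Δ tpd tpp c c₂ d x₀ x₀ ε = jet6P Δ tpd tpp c c₂ d x₀ x₀ ε := by
  unfold jet6Q jet6P p6x p6y; ring

/-- At a diagonal point the two mixed energy derivatives agree. [folklore] -/
theorem p6ye_diag (Δ tpd tpp c c₂ d x₀ ε : ℝ) : p6ye Δ tpd tpp c c₂ d x₀ x₀ ε = p6xe Δ tpd tpp c c₂ d x₀ x₀ ε := by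
  unfold p6ye p6xe; ring

/-- The jet's one-band `t″` at a diagonal point of the extended band: `t″_J = −E_xx/32`. [folklore] -/
def jet6Tpp (Δ tpd tpp c c₂ d x₀ ε : ℝ) : ℝ := -jet6R Δ tpd tpp c c₂ d x₀ x₀ ε / 32

/-- The jet's one-band `t′` at a diagonal point of the extended band: `t′_J = −E_xy/16`. [folklore] -/
def jet6Tp (Δ tpd tpp c c₂ d x₀ ε : ℝ) : ℝ := -jet6S Δ tpd tpp c c₂ d x₀ x₀ ε / 16

/-- **THE ENERGY-BLIND FOLD**: at every diagonal point of the σ + `t_pp″` + `t_dd` band,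
`t′_J − 2t″_J = (∂ₓ∂_yF − ∂ₓ²F)/(16∂_εF) = (p6xy − 2·p6xx2)/(16·p6e)` — the energy derivatives `∂ₓ∂_εF`, `∂_ε²F`
CANCEL: the fold of the jet sees only the `(x, y)`-Hessian of the secular polynomial (`∂_εF ≠ 0`). [folklore] -/
theorem jet6_fold {Δ tpd tpp c c₂ d x₀ ε : ℝ} (hF : p6e Δ tpd tpp c c₂ d x₀ x₀ ε ≠ 0) :
    jet6Tp Δ tpd tpp c c₂ d x₀ ε - 2 * jet6Tpp Δ tpd tpp c c₂ d x₀ ε =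
      (p6xy Δ tpd tpp c c₂ d x₀ x₀ ε - 2 * p6xx2 Δ tpd tpp c c₂ d x₀ x₀ ε) / (16 * p6e Δ tpd tpp c c₂ d x₀ x₀ ε) := by
  unfold jet6Tp jet6Tpp jet6S jet6R
  rw [jet6Q_diag, p6ye_diag]
  field_simp
  ring

/-- **THE BRIDGE SURVIVES `t_pp″`** (`d = 0`): `t′_J − 2t″_J = (fsTp5 − 2·fsTpp5)/∂_εF` — the whole-band fold of the
σ + `t_pp″` model equals the fold of its EXACT `t–t′–t″` contour hoppings (`EmeryFermiSurfaceHarmonics` §3) over the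
velocity denominator; at `c₂ = 0` this is `EmeryBandJet`'s `−fsN/∂_εF`. [folklore] -/
theorem jet6_fold_tdd_zero {Δ tpd tpp c c₂ x₀ ε : ℝ} (hF : p6e Δ tpd tpp c c₂ 0 x₀ x₀ ε ≠ 0) :
    jet6Tp Δ tpd tpp c c₂ 0 x₀ ε - 2 * jet6Tpp Δ tpd tpp c c₂ 0 x₀ ε =
      (fsTp5 tpd tpp c c₂ ε - 2 * fsTpp5 tpd c c₂ ε) / p6e Δ tpd tpp c c₂ 0 x₀ x₀ ε := by
  rw [jet6_fold hF, (p6_hessian_tdd_zero Δ tpd tpp c c₂ x₀ x₀ ε).1, (p6_hessian_tdd_zero Δ tpd tpp c c₂ x₀ x₀ ε).2]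
  unfold fsTp5 fsTpp5
  field_simp

/-- Consistency with §B.100: at `c₂ = d = 0` the extended fold is `−fsN/dcharCubic`. [folklore] -/
theorem jet6_fold_zero_zero {Δ tpd tpp c x₀ ε : ℝ} (hF : dcharCubic Δ tpd tpp c x₀ x₀ ε ≠ 0) :
    jet6Tp Δ tpd tpp c 0 0 x₀ ε - 2 * jet6Tpp Δ tpd tpp c 0 0 x₀ ε = -fsN tpd tpp c ε / dcharCubic Δ tpd tpp c x₀ x₀ ε := by
  have hF' : p6e Δ tpd tpp c 0 0 x₀ x₀ ε ≠ 0 := by rwa [p6e_zero_zero]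
  rw [jet6_fold hF', p6xy_zero_zero, p6xx2_zero_zero, p6e_zero_zero]
  field_simp
  ring

end Summit.Ventures.CertifiedManyBodySolver.Downfold.Emery
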